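import Summits.ValiantsHypothesis.ValiantsHypothesis.Theses.KPlusLogSqLaw
import Summits.ValiantsHypothesis.ValiantsHypothesis.Theorems.KPlusLogSqLawTropicalBVertexCount

/-!
# Route «KPlusLogSqLaw», crux `TropicalB` (stmt-ValiantsHypothesis-19771) — integer slopes are inessential:
# `TropicalB` ⟺ «every dominance design has at most 2^(C (K + ⌊log₂ m⌋²)) terms exposed at some RATIONAL slope»
# (= vertices of the upper envelope with a unique optimal term; every vertex of a polygon is exposed at a rational slope)

HONEST FRAMING.  Helper file toward the registered stub `stub_tropFat` (⟺ `TropicalB`) of `Cruxes/TropicalB/Lines/birth.lean`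
(crux `Summit.ValiantsHypothesis.ValiantsHypothesis.Theses.KPlusLogSqLaw.TropicalB`, ledger item `stmt-ValiantsHypothesis-19771`,
route `KPlusLogSqLaw`; cell `pub-symmetroid`, seat val-sym-trop-p2 (g2), 2026-08-26).  A reformulation of an OPEN statement; nothing
is asserted about `TropicalB`, `WeakLifting`, `KPlusLogSqLaw`, `MatrixDescartes` (stmt-ValiantsHypothesis-18050) or VP ≠ VNP.

The tree's rows test dominance at INTEGER slopes `θ`.  A term `p` is exposed at the rational slope `a/q` of the design `(d, v, ε)`
iff it is dominant at the integer slope `a` of the SCALED design `(d, q·v, ε)` (`tropWeight d (q·v) (q·θ) = q · tropWeight d v θ`,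
`isDominant_scale`); so «exposed at some rational slope» is spelled `∃ q > 0, ∃ a ∈ ℤ, IsDominant d (q·v) ε a p` (no new definition).

* `isDominant_scale` — scaling `v` and `θ` by the same positive integer preserves dominance;
* `card_ratDominant_le` — the rationally exposed terms of `(d, v, ε)` are integer-exposed terms of ONE scaled design `(d, Q·v, ε)`
  (`Q` = the product of the denominators), hence bounded by the vertex-count bound of `…TropicalBVertexCount`;
* `tropicalB_iff_cardRatDominant` — `TropicalB ↔ ∃ C, ∀ m K d v ε, #{p : ∃ q > 0, ∃ a, IsDominant d (q·v) ε a p} ≤ 2^(C (K+⌊log₂ m⌋²))`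
  (same constant both ways).

READING (located, not claimed).  Together with `…PermutationBudget`, `…SignsFree`, `…VertexCount`: the crux is the statement that
the planar point set `{(Σ_b d(λ b), Σ_b v(σ b, b, λ b)) : (σ, λ) present}` of an `m × m` dominance design with `K` slope classes has
at most `2^(O(K + log² m))` upper-hull vertices carried by a single term — no signs, chains, or integrality left in the statement.
[folklore] clearing denominators.
-/

set_option linter.dupNamespace false
set_option autoImplicit false

namespace Summit.ValiantsHypothesis.ValiantsHypothesis.Theorems.KPlusLogSqLaw

open Summit.ValiantsHypothesis.ValiantsHypothesis.Theorems.LacunarySymmetroidMatrixDescartes.TropicalCensus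
open Summit.ValiantsHypothesis.ValiantsHypothesis.Theorems.MatrixDescartes.Negative
open Summit.ValiantsHypothesis.ValiantsHypothesis.Theses.KPlusLogSqLaw (TropicalB)
open Finset

section RationalSlopes

variable {m K : ℕ}

/-- Scaling the valuations and the slope by the same factor scales every tropical weight. [folklore] -/
theorem tropWeight_scale (d : Fin K → ℕ) (v : Fin m → Fin m → Fin K → ℤ) (r θ : ℤ)
    (p : Equiv.Perm (Fin m) × (Fin m → Fin K)) :
    tropWeight d (fun a b l => r * v a b l) (r * θ) p = r * tropWeight d v θ p := by
  simp only [tropWeight, ← Finset.mul_sum]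
  ring

/-- **Dominance is scale-invariant**: if `p` is dominant at slope `θ` for `(d, v, ε)` then it is dominant at slope `r·θ` for
`(d, r·v, ε)`, `r > 0`. [folklore] -/
theorem isDominant_scale (d : Fin K → ℕ) (v ε : Fin m → Fin m → Fin K → ℤ) {r : ℤ} (hr : 0 < r) {θ : ℤ}
    {p : Equiv.Perm (Fin m) × (Fin m → Fin K)} (hp : IsDominant d v ε θ p) :
    IsDominant d (fun a b l => r * v a b l) ε (r * θ) p := by
  refine ⟨hp.1, fun p' hne hp' => ?_⟩
  rw [tropWeight_scale, tropWeight_scale]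
  exact mul_lt_mul_of_pos_left (hp.2 p' hne hp') hr

/-- Integer exposure is rational exposure with denominator `1`. [folklore] -/
theorem ratDominant_of_dominant (d : Fin K → ℕ) (v ε : Fin m → Fin m → Fin K → ℤ) {θ : ℤ}
    {p : Equiv.Perm (Fin m) × (Fin m → Fin K)} (hp : IsDominant d v ε θ p) :
    ∃ q : ℕ, 0 < q ∧ ∃ a : ℤ, IsDominant d (fun i j l => (q : ℤ) * v i j l) ε a p := by
  refine ⟨1, one_pos, θ, ?_⟩
  have h : (fun i j l => ((1 : ℕ) : ℤ) * v i j l) = v := by funext i j l; simp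
  rw [h]
  exact hp

open scoped Classical in
/-- **Clearing denominators.**  The terms of `(d, v, ε)` exposed at some rational slope are all integer-exposed terms of the single
scaled design `(d, Q·v, ε)`, `Q` = product of the denominators; hence their number is at most any bound valid for the integer-exposed
terms of every design of the same format. [folklore] -/
theorem card_ratDominant_le (d : Fin K → ℕ) (v ε : Fin m → Fin m → Fin K → ℤ) {M : ℕ}
    (hM : ∀ w : Fin m → Fin m → Fin K → ℤ,
      (univ.filter fun q : Equiv.Perm (Fin m) × (Fin m → Fin K) => ∃ t : ℤ, IsDominant d w ε t q).card ≤ M) :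
    (univ.filter fun p : Equiv.Perm (Fin m) × (Fin m → Fin K) =>
      ∃ q : ℕ, 0 < q ∧ ∃ a : ℤ, IsDominant d (fun i j l => (q : ℤ) * v i j l) ε a p).card ≤ M := by
  classical
  set R := univ.filter fun p : Equiv.Perm (Fin m) × (Fin m → Fin K) =>
      ∃ q : ℕ, 0 < q ∧ ∃ a : ℤ, IsDominant d (fun i j l => (q : ℤ) * v i j l) ε a p with hR
  have hmem : ∀ p ∈ R, ∃ q : ℕ, 0 < q ∧ ∃ a : ℤ, IsDominant d (fun i j l => (q : ℤ) * v i j l) ε a p :=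
    fun p hp => (mem_filter.mp hp).2
  choose! den hden num hnum using hmem
  set Q : ℕ := ∏ p ∈ R, den p with hQ
  have hQpos : 0 < Q := Finset.prod_pos fun p hp => hden p hp
  -- every rationally exposed term is integer-exposed for the design `Q • v`
  have hsub : R ⊆ univ.filter fun q : Equiv.Perm (Fin m) × (Fin m → Fin K) =>
      ∃ t : ℤ, IsDominant d (fun i j l => (Q : ℤ) * v i j l) ε t q := by
    intro p hp
    have hdvd : den p ∣ Q := Finset.dvd_prod_of_mem den hp
    obtain ⟨r, hr⟩ := hdvd
    have hrpos : 0 < r := by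
      rcases Nat.eq_zero_or_pos r with h0 | h0
      · rw [h0, mul_zero] at hr; omega
      · exact h0
    have h1 := isDominant_scale d (fun i j l => (den p : ℤ) * v i j l) ε (r := (r : ℤ)) (by exact_mod_cast hrpos) (hnum p hp)
    have h2 : (fun a b l => (r : ℤ) * ((den p : ℤ) * v a b l)) = fun i j l => (Q : ℤ) * v i j l := by
      funext a b l
      rw [hr]
      push_cast
      ring
    rw [h2] at h1
    exact mem_filter.mpr ⟨mem_univ _, _, h1⟩
  exact (card_le_card hsub).trans (hM _)

open scoped Classical in
/-- **`TropicalB` ⟺ the rational vertex count** (same constant both ways): the crux says that every dominance design of format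
`(m, K)` has at most `2^(C (K + ⌊log₂ m⌋²))` terms that are the unique tropical optimum at some RATIONAL slope `a/q` — i.e. that many
vertices of the upper envelope `θ ↦ max_p tropWeight d v θ p` carried by a single term. -/
theorem tropicalB_iff_cardRatDominant :
    TropicalB ↔ ∃ C : ℕ, ∀ (m K : ℕ) (d : Fin K → ℕ) (v ε : Fin m → Fin m → Fin K → ℤ),
      (univ.filter fun p : Equiv.Perm (Fin m) × (Fin m → Fin K) =>
        ∃ q : ℕ, 0 < q ∧ ∃ a : ℤ, IsDominant d (fun i j l => (q : ℤ) * v i j l) ε a p).card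
        ≤ 2 ^ (C * (K + Nat.log 2 m ^ 2)) := by
  classical
  constructor
  · intro hTB
    obtain ⟨C, hC⟩ := tropicalB_iff_cardDominant.mp hTB
    exact ⟨C, fun m K d v ε => card_ratDominant_le d v ε fun w => hC m K d w ε⟩
  · rintro ⟨C, hC⟩
    refine tropicalB_iff_cardDominant.mpr ⟨C, fun m K d v ε => ?_⟩
    refine le_trans (card_le_card fun p hp => ?_) (hC m K d v ε)
    obtain ⟨-, t, ht⟩ := mem_filter.mp hp
    exact mem_filter.mpr ⟨mem_univ _, ratDominant_of_dominant d v ε ht⟩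

end RationalSlopes

end Summit.ValiantsHypothesis.ValiantsHypothesis.Theorems.KPlusLogSqLaw
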